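import Summits.BirchSwinnertonDyer.Rank1Residual.ManinAdditive.KummerCubeMonodromy
import Literature.NumberTheory.EllipticCurves.HeckeOperatorsProofs
import Mathlib.Analysis.Normed.Ring.InfiniteSum
import HarnessLib

/-!
# Leaf S2 of the `σ`-monodromy line CLOSED: `QExpansionCubeIdentityPrinciple`
# (route `ManinLocalTwoThree`, crux C3 `ManinPrimeToThreeAtNine` stmt-BirchSwinnertonDyer-22968; cell bsd-f2-manin, p2 gen 16)

Sequel of `Theorems/ManinLocalTwoThreeKummerCubeSigmaLeaves.lean` (S3′, S3b, S6).  The statement file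
`Rank1Residual/ManinAdditive/KummerCubeMonodromy.lean` (an g37, MEMO-an §80) reduces P79 / G0 to seven leaves; this file PROVES

* `qExpansionCubeIdentityPrinciple : QExpansionCubeIdentityPrinciple` (S2): if `F̂³ = Θ·Ĝ³` in `ℂ⟦q⟧` for
  `F, G ∈ M_k(Γ₀(M))` and `Θ` sums to `θ(τ)` for `Im τ > B`, then `F(τ)³ = θ(τ)·G(τ)³` there.

Ingredients: the `q`-expansion of a modular form on `Γ₀(M)` sums to the form at every `τ` (Mathlib
`UpperHalfPlane.hasSum_qExpansion`, width `1` via the tree's `one_mem_strictPeriods_gamma0`; `hasSum_qExpansion_modularForm_gamma0`);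
summability in `ℂ` is absolute (`HasSum.summable.norm`), so the evaluated coefficients of a product of power series form the Cauchy
product of the evaluated factors (`hasSum_coeff_mul_pow_mul`: `PowerSeries.coeff_mul` +
`tsum_mul_tsum_eq_tsum_sum_antidiagonal_of_summable_norm`); equal power series have equal sums (`HasSum.unique`).
So, with `…KummerCubeSigmaLeaves`, the open leaves of the line are S1 (analytic dictionary), S3 (`ℓ_a = C·W³`), S4 (monodromy).
HONEST FRAMING: a routine analytic leaf of a CONDITIONAL reduction; P79, G0, E-an-57 and C3 remain OPEN; nothing about BSD or
Manin's conjecture is proved.  [cite: DiamondShurman2005, §1.1–1.2 (q-expansions)]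
-/

set_option autoImplicit false
set_option linter.dupNamespace false

noncomputable section

open Complex PowerSeries Finset
open scoped UpperHalfPlane MatrixGroups ModularForm
open CongruenceSubgroup
open Literature.NumberTheory.EllipticCurves Literature.NumberTheory.EllipticCurves.ModularForms

namespace Summit.BirchSwinnertonDyer.BirchSwinnertonDyer.Theorems.ManinLocalTwoThree.KummerCubeSigmaLeaves

open Summit.BirchSwinnertonDyer.Rank1Residual.ManinAdditive.KummerCubeMonodromy

/-- **Cauchy product of evaluated power series.**  If `Σ coeff n P · qⁿ` and `Σ coeff n Q · qⁿ` are summable (in `ℂ`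
summability is absolute), then `Σ coeff n (P·Q) · qⁿ` sums to the product of the two sums. [folklore] -/
theorem hasSum_coeff_mul_pow_mul {P Q : PowerSeries ℂ} {q p s : ℂ}
    (hP : HasSum (fun n : ℕ ↦ coeff n P * q ^ n) p) (hQ : HasSum (fun n : ℕ ↦ coeff n Q * q ^ n) s) :
    HasSum (fun n : ℕ ↦ coeff n (P * Q) * q ^ n) (p * s) := by
  set f : ℕ → ℂ := fun n ↦ coeff n P * q ^ n with hf
  set g : ℕ → ℂ := fun n ↦ coeff n Q * q ^ n with hg
  have hPn : Summable fun n : ℕ ↦ ‖f n‖ := hP.summable.norm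
  have hQn : Summable fun n : ℕ ↦ ‖g n‖ := hQ.summable.norm
  have hterm : (fun n : ℕ ↦ coeff n (P * Q) * q ^ n) = fun n ↦ ∑ kl ∈ antidiagonal n, f kl.1 * g kl.2 := by
    funext n
    rw [PowerSeries.coeff_mul, Finset.sum_mul]
    refine Finset.sum_congr rfl fun kl hkl ↦ ?_
    have hkl' : kl.1 + kl.2 = n := Finset.HasAntidiagonal.mem_antidiagonal.mp hkl
    simp only [hf, hg]
    rw [← hkl', pow_add]
    ring
  have hsum : Summable fun n : ℕ ↦ ∑ kl ∈ antidiagonal n, f kl.1 * g kl.2 :=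
    summable_sum_mul_antidiagonal_of_summable_norm' hPn hP.summable hQn hQ.summable
  have htsum : (∑' n, f n) * (∑' n, g n) = ∑' n, ∑ kl ∈ antidiagonal n, f kl.1 * g kl.2 :=
    tsum_mul_tsum_eq_tsum_sum_antidiagonal_of_summable_norm hPn hQn
  rw [hterm, ← hP.tsum_eq, ← hQ.tsum_eq, htsum]
  exact hsum.hasSum

/-- The `q`-expansion of a modular form on `Γ₀(M)` sums to it at every `τ ∈ ℍ` (width `1`). [cite: DiamondShurman2005, §1.1–1.2] -/
theorem hasSum_qExpansion_modularForm_gamma0 {M : ℕ} {k : ℤ} (F : ModularForm (Gamma0 M) k) (τ : ℍ) :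
    HasSum (fun n : ℕ ↦ coeff n (UpperHalfPlane.qExpansion 1 ⇑F) * Function.Periodic.qParam 1 (τ : ℂ) ^ n) (F τ) := by
  haveI : Fact (IsCusp OnePoint.infty ((Gamma0 M : Subgroup SL(2, ℤ)) : Subgroup (GL (Fin 2) ℝ))) :=
    ⟨Subgroup.isCusp_of_mem_strictPeriods one_pos (one_mem_strictPeriods_gamma0 M)⟩
  have h := UpperHalfPlane.hasSum_qExpansion one_pos
    (SlashInvariantFormClass.periodic_comp_ofComplex F (one_mem_strictPeriods_gamma0 M))
    (ModularFormClass.holo F) (ModularFormClass.bdd_at_infty F) τ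
  simpa [smul_eq_mul] using h

/-- **S2 `QExpansionCubeIdentityPrinciple` PROVED** (`q`-expansion principle for a cube relation): if `F̂³ = Θ·Ĝ³` in `ℂ⟦q⟧`
for `F, G ∈ M_k(Γ₀(M))` and `Θ` sums to `θ(τ)` for `Im τ > B`, then `F(τ)³ = θ(τ)G(τ)³` there — `q`-expansions sum to the
forms (`hasSum_qExpansion`), sums of products are Cauchy products (summability in `ℂ` is absolute), and equal power series
have equal sums. [cite: DiamondShurman2005, §1.1–1.2 (q-expansions; shape)] -/
theorem qExpansionCubeIdentityPrinciple : QExpansionCubeIdentityPrinciple := by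
  intro M _ k F G Θ θ B hΘ hPS τ hτ
  have hF := hasSum_qExpansion_modularForm_gamma0 F τ
  have hG := hasSum_qExpansion_modularForm_gamma0 G τ
  have hF3 : HasSum (fun n : ℕ ↦ coeff n (UpperHalfPlane.qExpansion 1 ⇑F ^ 3) * Function.Periodic.qParam 1 (τ : ℂ) ^ n)
      (F τ ^ 3) := by
    rw [pow_three, pow_three, ← mul_assoc, ← mul_assoc]
    exact hasSum_coeff_mul_pow_mul (hasSum_coeff_mul_pow_mul hF hF) hF
  have hG3 : HasSum (fun n : ℕ ↦ coeff n (UpperHalfPlane.qExpansion 1 ⇑G ^ 3) * Function.Periodic.qParam 1 (τ : ℂ) ^ n)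
      (G τ ^ 3) := by
    rw [pow_three, pow_three, ← mul_assoc, ← mul_assoc]
    exact hasSum_coeff_mul_pow_mul (hasSum_coeff_mul_pow_mul hG hG) hG
  have hΘG := hasSum_coeff_mul_pow_mul (hΘ τ hτ) hG3
  rw [← hPS] at hΘG
  exact hF3.unique hΘG

end Summit.BirchSwinnertonDyer.BirchSwinnertonDyer.Theorems.ManinLocalTwoThree.KummerCubeSigmaLeaves

end
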